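import Literature.AlgebraicGeometry.HodgeTheory.HodgeNumbersBirationalInvariance
import Literature.AlgebraicGeometry.HodgeTheory.BirationalRoofOfSmoothProjective
import HarnessLib

/-!
# The first Betti number is a birational invariant of smooth projective complex varieties: `b₁(X) = b₁(X')` for
# `X ~ X'` birational over `ℂ` (Hartshorne II Ex. 8.8 «`q = h^{1,0}` is a birational invariant» + `b₁ = 2q`)

[topic AlgebraicGeometry/HodgeTheory]

Layer `Literature/AlgebraicGeometry/HodgeTheory`. THEOREMS ONLY (no definition, no named fact, no instance, no notation).
Written for the cell `hodge-nonav` (prover seat `hodge-nonav-prover-Bx` g20), route `Q8SymplecticPowers`, crux K1Q stub S1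
`stub_regularVeryGeneralQ` («very generally every smooth model `X ~bir V_(c,ψ)` is regular, `b₁(X) = 0`»): it REDUCES S1 to ONE smooth model per
parameter (e.g. the fibre of the Q-family deck model), route-agnostic. Inputs (tree theorems): `h^{1,0}` is a birational invariant along a
birational MORPHISM (`BettiUniverse.hodgeNumber_hodge_zero_eq_of_isBirational`, `HodgeNumbersBirationalInvariance`), `b₁ = h^{1,0} + h^{0,1} = 2h^{1,0}`
(`BettiUniverse.finrank_bettiCohomology_eq_sum_hodgeNumber_hodge`, `hodgeNumber_hodge_symm`), and the smooth projective roof over a Mathlib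
`Scheme.BirationalOver` (`exists_isSmoothProjective_roof_of_birationalOver`, `BirationalRoofOfSmoothProjective`).

* `BettiUniverse.finrank_bettiCohomology_one_eq_two_mul_hodgeNumber` — `b₁(X) = 2 h^{1,0}(X)`.
* `BettiUniverse.finrank_bettiCohomology_one_eq_of_isBirational` — `b₁(X') = b₁(X)` along a birational morphism `X' → X`.
* **`BettiUniverse.finrank_bettiCohomology_one_eq_of_birationalOver`** — `b₁(X) = b₁(X')` for `Scheme.BirationalOver X.hom X'.hom`.

[cite: Hartshorne1977, II Ex. 8.8 and V Remark 5.6.1] [cite: VoisinHodgeI2002, §6.1.3 Cor. 6.12–6.13]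

Honest scope: Hodge-theoretic bookkeeping; nothing here proves S1 (which needs `b₁ = 0` for one model) or HC.
-/

noncomputable section

open CategoryTheory AlgebraicGeometry Finset Literature.AlgebraicGeometry Literature.AlgebraicGeometry.Motives
  Literature.AlgebraicGeometry.HodgeTheory Literature.AlgebraicGeometry.Resolution

namespace Literature.AlgebraicGeometry.HodgeTheory

/-- **`b₁(X) = 2 h^{1,0}(X)`** for a smooth projective complex variety (`b₁ = h^{0,1} + h^{1,0}`, Voisin I Cor. 6.13, and Hodge symmetry
`h^{0,1} = h^{1,0}`, Cor. 6.12). [cite: VoisinHodgeI2002, §6.1.3 Cor. 6.12 and Cor. 6.13] -/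
theorem BettiUniverse.finrank_bettiCohomology_one_eq_two_mul_hodgeNumber (hHD : exists_isReal_hodgeModel) {n : ℕ} {X : SchemeOver ℂ}
    (hX : IsSmoothProjective n X) :
    Module.finrank ℚ (bettiCohomology X 1) = 2 * (BettiUniverse.hodge hHD hX 1).hodgeNumber 1 0 := by
  have hs := BettiUniverse.hodgeNumber_hodge_symm hHD hX 1 0 1
  rw [BettiUniverse.finrank_bettiCohomology_eq_sum_hodgeNumber_hodge hHD hX 1]
  norm_num [Finset.sum_range_succ]
  rw [hs]
  omega

/-- **`b₁(X') = b₁(X)` along a birational MORPHISM `σ : X' → X`** of smooth projective complex `n`-folds (`h^{1,0}` is a birational invariant,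
Hartshorne II Ex. 8.8, tree `hodgeNumber_hodge_zero_eq_of_isBirational`; `b₁ = 2h^{1,0}`). [cite: Hartshorne1977, II Ex. 8.8]
[cite: VoisinHodgeI2002, §6.1.3 Cor. 6.13] -/
theorem BettiUniverse.finrank_bettiCohomology_one_eq_of_isBirational {n : ℕ} {X X' : SchemeOver ℂ} (hX' : IsSmoothProjective n X')
    (hX : IsSmoothProjective n X) (σ : X' ⟶ X) (hσ : IsBirational σ.left) :
    Module.finrank ℚ (bettiCohomology X' 1) = Module.finrank ℚ (bettiCohomology X 1) := by
  rw [BettiUniverse.finrank_bettiCohomology_one_eq_two_mul_hodgeNumber exists_isReal_hodgeModel_holds hX',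
    BettiUniverse.finrank_bettiCohomology_one_eq_two_mul_hodgeNumber exists_isReal_hodgeModel_holds hX]
  have h := BettiUniverse.hodgeNumber_hodge_zero_eq_of_isBirational exists_isReal_hodgeModel_holds hX' hX σ hσ 1
  push_cast at h
  rw [h]

/-- **The first Betti number is a birational invariant**: `b₁(X) = b₁(X')` for smooth projective complex `n`-folds that are birational over `ℂ`
(Mathlib `Scheme.BirationalOver`; through a smooth projective roof `X ← X'' → X'`, Hartshorne V Remark 5.6.1 / Hironaka).
[cite: Hartshorne1977, II Ex. 8.8 and V Remark 5.6.1] -/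
theorem BettiUniverse.finrank_bettiCohomology_one_eq_of_birationalOver {n : ℕ} {X X' : SchemeOver ℂ} (hX : IsSmoothProjective n X)
    (hX' : IsSmoothProjective n X') (h : Scheme.BirationalOver X.hom X'.hom) :
    Module.finrank ℚ (bettiCohomology X 1) = Module.finrank ℚ (bettiCohomology X' 1) := by
  obtain ⟨X'', p, q, hX'', hp, hq⟩ := exists_isSmoothProjective_roof_of_birationalOver hX hX' h
  rw [← BettiUniverse.finrank_bettiCohomology_one_eq_of_isBirational hX'' hX p hp,
    BettiUniverse.finrank_bettiCohomology_one_eq_of_isBirational hX'' hX' q hq]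

end Literature.AlgebraicGeometry.HodgeTheory

end
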